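import Summits.QuantumFields.YangMills.Theorems.AlphaInputsT3ACv3StartSystem
import HarnessLib

/-!
# `AlphaInputsT3ACv3StartRows` — non-abelian (FL), START v3 row (S5)-4 (iv): **THE NUMERAL ROWS OF THE START** — with `16 ≤ Lᵏ` and the tube bound `b := exp((2r+1)⁻²·2ε′) − 1`
# (`r = rT = ⌊Lᵏ/16⌋`, `R = RbT = 2r + 3`): `b ≤ 1024·ε′/L^{2k}`, `R ≤ 5Lᵏ/16`, `R²·b ≤ 100·ε′`, `R·b ≤ 20·ε′`, hence the shell rows `320R²b ≤ 1`, `4800Rb ≤ 1` and the two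
# `π`-rows at `n = Fin 2` all follow from the ONE absolute row `ε′ ≤ 10⁻⁵` — cell `ym3-torus`, width seat `ym-ust-19936-w5` (g2), the «free hand» item (iv) of ★w1-19936 g2 LEAD PROGRESS 6

WHY.  ★LEAD's ✓ p602769 `TubeStart.dist1_plaqHol_startT3_le` displays the binders `hR : 1 ≤ RbT`, `hb : 0 ≤ b`, `hsmall : 320·RbT²·b ≤ 1`, `h4800 : 4800·RbT·b ≤ 1`,
`hπ : |n|·(200·RbT·b) < π`, `hπ' : |n|·(20·RbT²·b) < π`, `hRL : 2·RbT + 1 ≤ Lᵏ`; downstream (★w4 (K1)–(K7), ★w5 (S6)) everything is linear in `ε′` once `b` is.  THIS FILE is the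
arithmetic, once: §1 `rT_pos`, `one_le_RbT`, `two_mul_RbT_add_one_le`, `sixteen_mul_rT_le`, `cast_RbT_le` (`R ≤ 5Lᵏ/16`), `cast_two_rT_add_one_ge` (`2r+1 ≥ Lᵏ/16`); §2 ★ `tubeBound_le` (`b ≤ 1024ε′/L^{2k}`), `tubeBound_nonneg`; §3 ★★ `startRows` (the six displayed rows from `16 ≤ Lᵏ`, `0 ≤ ε′ ≤ 10⁻⁵`, `|n| = 2`); §4 `eta0_le_of_boxBound` (the (S6) numeral: `2(d+1)Lᵏ·((d⌊Lᵏ/2⌋ + Lᵏ)·b′) ≤ (d+1)(d+2)·C·ε′` for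
`b′ ≤ Cε′/(Lᵏ)²`; `d = 3`, `C = 1024`: `η₀ ≤ 20480·ε′`).
HONEST FRAMING.  Numerals; count-neutral helper toward R3 2′ (items 19936∕19935, `--supports stmt-QuantumFields-19936`); `hLift`∕(FL), the stub, the crux and the gap are NOT claimed;
registry untouched; YM₃ on T³ is rung R3 of the YM ladder, not the Clay problem.

References: T. Bałaban, Commun. Math. Phys. 102 (1985) 277–309 [Balaban1985Variational] ((14) p.280, Thm 1 (8) p.279).
-/

set_option autoImplicit false

namespace Summit.QuantumFields.YangMills.Theorems.TubeStart

open Literature.MathematicalPhysics.QuantumFieldTheory.Balaban1983to89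

variable (P : Params) (k : ℕ)

/-! ## §1 The radii against `Lᵏ` -/

/-- `16·rT ≤ Lᵏ < 16·rT + 16`. [folklore] -/
theorem sixteen_mul_rT_le : 16 * rT P k ≤ P.L ^ k ∧ P.L ^ k < 16 * rT P k + 16 := by
  unfold rT; omega

/-- `1 ≤ rT` when `16 ≤ Lᵏ`. [folklore] -/
theorem rT_pos (hLk : 16 ≤ P.L ^ k) : 1 ≤ rT P k := by
  unfold rT; omega

/-- `1 ≤ RbT`. [folklore] -/
theorem one_le_RbT : 1 ≤ RbT P k := by unfold RbT; omega

/-- `2·RbT + 1 ≤ Lᵏ` when `16 ≤ Lᵏ` (the vertex cube fits in a cell). [folklore] -/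
theorem two_mul_RbT_add_one_le (hLk : 16 ≤ P.L ^ k) : 2 * RbT P k + 1 ≤ P.L ^ k := by
  unfold RbT rT; omega

/-- `RbT ≤ 5·Lᵏ/16` (reals) when `16 ≤ Lᵏ`. [folklore] -/
theorem cast_RbT_le (hLk : 16 ≤ P.L ^ k) : (RbT P k : ℝ) ≤ 5 * (P.L ^ k : ℕ) / 16 := by
  have h := sixteen_mul_rT_le P k
  have h1 : (16 : ℝ) * (rT P k : ℝ) ≤ ((P.L ^ k : ℕ) : ℝ) := by exact_mod_cast h.1
  have h2 : (16 : ℝ) ≤ ((P.L ^ k : ℕ) : ℝ) := by exact_mod_cast hLk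
  have e : (RbT P k : ℝ) = 2 * (rT P k : ℝ) + 3 := by unfold RbT; push_cast; ring
  rw [e]; linarith

/-- `Lᵏ/16 ≤ 2·rT + 1` (reals). [folklore] -/
theorem cast_two_rT_add_one_ge : ((P.L ^ k : ℕ) : ℝ) / 16 ≤ 2 * (rT P k : ℝ) + 1 := by
  have h := sixteen_mul_rT_le P k
  have h2 : ((P.L ^ k : ℕ) : ℝ) < 16 * (rT P k : ℝ) + 16 := by exact_mod_cast h.2
  have h0 : (0 : ℝ) ≤ (rT P k : ℝ) := Nat.cast_nonneg _
  linarith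

/-! ## §2 The tube bound -/

/-- **THE TUBE BOUND IS LINEAR IN `ε′`**: `exp((2r+1)⁻²·2ε′) − 1 ≤ 1024·ε′/(Lᵏ)²` for `0 ≤ ε′ ≤ 1/4`. [cite: Balaban1985Variational, (14) p.280] -/
theorem tubeBound_le {ε' : ℝ} (hε0 : 0 ≤ ε') (hε : ε' ≤ 1 / 4) :
    Real.exp (((2 * (rT P k : ℝ) + 1))⁻¹ ^ 2 * (2 * ε')) - 1 ≤ 1024 * ε' / ((P.L ^ k : ℕ) : ℝ) ^ 2 := by
  have hL : (0 : ℝ) < ((P.L ^ k : ℕ) : ℝ) := by exact_mod_cast pow_pos P.L_pos k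
  have hr0 : (0 : ℝ) ≤ (rT P k : ℝ) := Nat.cast_nonneg _
  have hs : (1 : ℝ) ≤ 2 * (rT P k : ℝ) + 1 := by linarith
  have hspos : (0 : ℝ) < 2 * (rT P k : ℝ) + 1 := by linarith
  have hge := cast_two_rT_add_one_ge P k
  set s : ℝ := 2 * (rT P k : ℝ) + 1 with hsdef
  set x : ℝ := (s)⁻¹ ^ 2 * (2 * ε') with hx
  have hinv : (s)⁻¹ ≤ 1 := inv_le_one_of_one_le₀ hs
  have hinv0 : 0 ≤ (s)⁻¹ := inv_nonneg.mpr hspos.le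
  have hx0 : 0 ≤ x := by positivity
  have hx1 : x ≤ 1 / 2 := by
    have : (s)⁻¹ ^ 2 ≤ 1 := by nlinarith
    rw [hx]; nlinarith
  -- `eˣ − 1 ≤ 2x` on `[0, 1/2]` (`eˣ ≤ 1/(1−x)`; the tree's `SmoothLiftFibre.exp_sub_one_le_two_mul`, re-derived to keep the import light)
  have hexp : Real.exp x - 1 ≤ 2 * x := by
    have h := Real.exp_bound_div_one_sub_of_interval hx0 (by linarith)
    have hx1' : 0 < 1 - x := by linarith
    have : 1 / (1 - x) ≤ 1 + 2 * x := by rw [div_le_iff₀ hx1']; nlinarith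
    linarith
  refine hexp.trans ?_
  -- `2x = 4ε′/s² ≤ 4ε′·256/(Lᵏ)²`
  rw [hx, inv_pow, le_div_iff₀ (by positivity)]
  have hsq : ((P.L ^ k : ℕ) : ℝ) ^ 2 / 256 ≤ s ^ 2 := by
    have : ((P.L ^ k : ℕ) : ℝ) / 16 ≤ s := hge
    have h16 : (0 : ℝ) ≤ ((P.L ^ k : ℕ) : ℝ) / 16 := by positivity
    nlinarith
  have hs2 : (0 : ℝ) < s ^ 2 := by positivity
  calc 2 * ((s ^ 2)⁻¹ * (2 * ε')) * ((P.L ^ k : ℕ) : ℝ) ^ 2 = 4 * ε' * (((P.L ^ k : ℕ) : ℝ) ^ 2 / s ^ 2) := by field_simp; ring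
    _ ≤ 4 * ε' * 256 := by
        refine mul_le_mul_of_nonneg_left ?_ (by positivity)
        rw [div_le_iff₀ hs2]; linarith
    _ = 1024 * ε' := by ring

/-- The tube bound is nonnegative. [folklore] -/
theorem tubeBound_nonneg {ε' : ℝ} (hε0 : 0 ≤ ε') : 0 ≤ Real.exp (((2 * (rT P k : ℝ) + 1))⁻¹ ^ 2 * (2 * ε')) - 1 := by
  have : 0 ≤ ((2 * (rT P k : ℝ) + 1))⁻¹ ^ 2 * (2 * ε') := by positivity
  linarith [Real.add_one_le_exp (((2 * (rT P k : ℝ) + 1))⁻¹ ^ 2 * (2 * ε'))]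

/-! ## §3 The rows -/

/-- **★★ THE START'S NUMERAL ROWS FROM ONE ABSOLUTE ROW**: for `16 ≤ Lᵏ`, `0 ≤ ε′ ≤ 10⁻⁵` and the tube bound `b := exp((2·rT+1)⁻²·2ε′) − 1`:
`0 ≤ b`, `b ≤ 1024ε′/(Lᵏ)²`, `1 ≤ RbT`, `2·RbT + 1 ≤ Lᵏ`, `320·RbT²·b ≤ 1`, `4800·RbT·b ≤ 1`, `2·(200·RbT·b) < π`, `2·(20·RbT²·b) < π` (`|Fin 2| = 2`) — the displayed binders of
`dist1_plaqHol_startT3_le` at `n = Fin 2`. [cite: Balaban1985Variational, (14) p.280, Thm 1 (8) p.279] -/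
theorem startRows (hLk : 16 ≤ P.L ^ k) {ε' : ℝ} (hε0 : 0 ≤ ε') (hε : ε' ≤ 1 / 100000) :
    0 ≤ Real.exp (((2 * (rT P k : ℝ) + 1))⁻¹ ^ 2 * (2 * ε')) - 1 ∧
    Real.exp (((2 * (rT P k : ℝ) + 1))⁻¹ ^ 2 * (2 * ε')) - 1 ≤ 1024 * ε' / ((P.L ^ k : ℕ) : ℝ) ^ 2 ∧
    1 ≤ RbT P k ∧ 2 * RbT P k + 1 ≤ P.L ^ k ∧
    320 * (RbT P k : ℝ) ^ 2 * (Real.exp (((2 * (rT P k : ℝ) + 1))⁻¹ ^ 2 * (2 * ε')) - 1) ≤ 1 ∧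
    4800 * (RbT P k : ℝ) * (Real.exp (((2 * (rT P k : ℝ) + 1))⁻¹ ^ 2 * (2 * ε')) - 1) ≤ 1 ∧
    (2 : ℝ) * (200 * (RbT P k : ℝ) * (Real.exp (((2 * (rT P k : ℝ) + 1))⁻¹ ^ 2 * (2 * ε')) - 1)) < Real.pi ∧
    (2 : ℝ) * (20 * (RbT P k : ℝ) ^ 2 * (Real.exp (((2 * (rT P k : ℝ) + 1))⁻¹ ^ 2 * (2 * ε')) - 1)) < Real.pi := by
  set b : ℝ := Real.exp (((2 * (rT P k : ℝ) + 1))⁻¹ ^ 2 * (2 * ε')) - 1 with hb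
  have hb0 : 0 ≤ b := tubeBound_nonneg P k hε0
  have hbT : b ≤ 1024 * ε' / ((P.L ^ k : ℕ) : ℝ) ^ 2 := tubeBound_le P k hε0 (hε.trans (by norm_num))
  have hL : (16 : ℝ) ≤ ((P.L ^ k : ℕ) : ℝ) := by exact_mod_cast hLk
  have hLpos : (0 : ℝ) < ((P.L ^ k : ℕ) : ℝ) := by linarith
  have hR := cast_RbT_le P k hLk
  have hR0 : (0 : ℝ) ≤ (RbT P k : ℝ) := Nat.cast_nonneg _
  -- `R²·b ≤ 100ε′` and `R·b ≤ 20ε′`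
  have hR2b : (RbT P k : ℝ) ^ 2 * b ≤ 100 * ε' := by
    calc (RbT P k : ℝ) ^ 2 * b ≤ (5 * ((P.L ^ k : ℕ) : ℝ) / 16) ^ 2 * (1024 * ε' / ((P.L ^ k : ℕ) : ℝ) ^ 2) :=
          mul_le_mul (pow_le_pow_left₀ hR0 hR 2) hbT hb0 (by positivity)
      _ = 100 * ε' := by field_simp; ring
  have hRb : (RbT P k : ℝ) * b ≤ 20 * ε' := by
    calc (RbT P k : ℝ) * b ≤ (5 * ((P.L ^ k : ℕ) : ℝ) / 16) * (1024 * ε' / ((P.L ^ k : ℕ) : ℝ) ^ 2) := mul_le_mul hR hbT hb0 (by positivity)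
      _ = 320 * ε' / ((P.L ^ k : ℕ) : ℝ) := by field_simp; ring
      _ ≤ 320 * ε' / 16 := div_le_div_of_nonneg_left (by positivity) (by norm_num) hL
      _ = 20 * ε' := by ring
  have hπ3 : (3 : ℝ) < Real.pi := Real.pi_gt_three
  refine ⟨hb0, hbT, one_le_RbT P k, two_mul_RbT_add_one_le P k hLk, ?_, ?_, ?_, ?_⟩
  · nlinarith
  · nlinarith
  · nlinarith
  · nlinarith

/-! ## §4 The (S6) defect numeral -/

/-- **THE (S6) `η₀` NUMERAL**: if the two-cell box plaquette bound is `b′ ≤ C·ε′/(Lᵏ)²`, the defect bound of ★`StartDefectBox.norm_startDefect_sub_one_le_twoCell`,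
`2(d+1)Lᵏ·((d·⌊Lᵏ/2⌋ + Lᵏ)·b′)`, is at most `(d+1)(d+2)·C·ε′` — k-FREE; at `d = 3`, `C = 1024`: `η₀ ≤ 20480·ε′` (and `C = 81601·1024` through the vertex cubes accordingly).
[cite: Balaban1985Variational, Thm 1 (8) p.279, (11)–(13) pp.279–280] -/
theorem eta0_le_of_boxBound {ε' C b' : ℝ} (hb0 : 0 ≤ b') (hb : b' ≤ C * ε' / ((P.L ^ k : ℕ) : ℝ) ^ 2) :
    2 * (((P.d : ℝ) + 1) * (P.L : ℝ) ^ k * (((P.d * (P.L ^ k / 2) + P.L ^ k : ℕ) : ℝ) * b')) ≤ ((P.d : ℝ) + 1) * ((P.d : ℝ) + 2) * C * ε' := by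
  have hLpos : (0 : ℝ) < ((P.L ^ k : ℕ) : ℝ) := by exact_mod_cast pow_pos P.L_pos k
  have hcast : ((P.L : ℝ)) ^ k = ((P.L ^ k : ℕ) : ℝ) := by push_cast; ring
  have hhalf : (((P.L ^ k / 2 : ℕ) : ℕ) : ℝ) * 2 ≤ ((P.L ^ k : ℕ) : ℝ) := by exact_mod_cast Nat.div_mul_le_self (P.L ^ k) 2
  have hD : (((P.d * (P.L ^ k / 2) + P.L ^ k : ℕ) : ℕ) : ℝ) ≤ ((P.d : ℝ) + 2) * ((P.L ^ k : ℕ) : ℝ) / 2 := by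
    push_cast
    have hd0 : (0 : ℝ) ≤ (P.d : ℝ) := Nat.cast_nonneg _
    nlinarith
  have hd1 : (0 : ℝ) ≤ (P.d : ℝ) + 1 := by positivity
  rw [hcast]
  set N : ℝ := ((P.L ^ k : ℕ) : ℝ) with hN
  -- `L^k · (D · b′) ≤ (d+2)/2 · (L^k)² · b′ ≤ (d+2)/2 · C ε′`
  have h1 : N * ((((P.d * (P.L ^ k / 2) + P.L ^ k : ℕ) : ℕ) : ℝ) * b') ≤ N * (((P.d : ℝ) + 2) * N / 2 * b') :=
    mul_le_mul_of_nonneg_left (mul_le_mul_of_nonneg_right hD hb0) hLpos.le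
  have h2 : N * (((P.d : ℝ) + 2) * N / 2 * b') = ((P.d : ℝ) + 2) / 2 * (N ^ 2 * b') := by ring
  have h3 : N ^ 2 * b' ≤ C * ε' := by
    have hN2 : (0 : ℝ) < N ^ 2 := by positivity
    have := mul_le_mul_of_nonneg_left hb hN2.le
    have e : N ^ 2 * (C * ε' / N ^ 2) = C * ε' := by field_simp
    linarith [e]
  have h4 : ((P.d : ℝ) + 2) / 2 * (N ^ 2 * b') ≤ ((P.d : ℝ) + 2) / 2 * (C * ε') := mul_le_mul_of_nonneg_left h3 (by positivity)
  calc 2 * (((P.d : ℝ) + 1) * N * ((((P.d * (P.L ^ k / 2) + P.L ^ k : ℕ) : ℕ) : ℝ) * b'))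
      = 2 * ((P.d : ℝ) + 1) * (N * ((((P.d * (P.L ^ k / 2) + P.L ^ k : ℕ) : ℕ) : ℝ) * b')) := by ring
    _ ≤ 2 * ((P.d : ℝ) + 1) * (((P.d : ℝ) + 2) / 2 * (C * ε')) := by
        refine mul_le_mul_of_nonneg_left (h1.trans ?_) (by positivity)
        rw [h2]; exact h4
    _ = ((P.d : ℝ) + 1) * ((P.d : ℝ) + 2) * C * ε' := by ring

end Summit.QuantumFields.YangMills.Theorems.TubeStart
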